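import Summits.BirchSwinnertonDyer.BirchSwinnertonDyer.Theorems.PublishedInputsGreenbergControlAtTwoOfFour
import Summits.BirchSwinnertonDyer.BirchSwinnertonDyer.Theorems.ThetaPartnerAtTwoSignedControlAtTwoH1SigmaCorankBound
import Literature.NumberTheory.EllipticCurves.Greenberg1999.LocalQuotientControlSurjectiveProofs
import HarnessLib

set_option linter.dupNamespace false -- `…BirchSwinnertonDyer.BirchSwinnertonDyer…` is the cell's nested layout (D-0017)
set_option autoImplicit false

/-!
# Pack `PublishedInputsGreenbergControlAtTwo` (item 24143; routes `ThetaPartnerAtTwo` / `ResidualThetaTransportAtTwo`, binder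
# `hPubG`) from TWO of its five conjuncts: three conjuncts are tree theorems

Seat `bsd-inputs-k4-p1` (gen 3; LADDER-BSD D-0154 KEY (147)(f) «prove the printed input», row 1 K4 INPUTS),
`--supports stmt-BirchSwinnertonDyer-24143`. THEOREMS ONLY (no definition, no named fact, no `sorry`); ROUTE-FREE (no `Theses/*.lean`
in the import closure — the route files may import it without a cycle). Sequel of seat `bsd-inputs-honda-p1`'s
`PublishedInputsGreenbergControlAtTwoOfFour` (conjunct 1, Cassels' Prop. 4.13 over `ℚ`, discharged by
`InputsPoitouTateSelmer.casselsSurjectivity_H1Sigma_holds ℚ`), which kept conjuncts 3 and 4 as hypotheses although both are tree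
theorems:

* conjunct 3 `Greenberg1999.h1Sigma_zpCorank_le_degree ℚ` (LNM 1716 §4 Appendix pp. 119–120: `Sel_E(ℚ)_p` finite ⟹
  `corank_{ℤ_p} H¹(ℚ_Σ/ℚ, E[p^∞]) ≤ 1`) = `SignedEC.H1SigmaCorank.h1Sigma_zpCorank_le_degree_holds_rat` (K4 width seat
  `bsd-wall-tp2-p3-w3` g4, p597712/p598417; route-free module `…SignedControlAtTwoH1SigmaCorankBound`);
* conjunct 4 `Greenberg1999.localQuotient_restriction_surjective ℚ` (LNM 1716 p. 108: restriction on the local quotients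
  `H¹(K_v, E[p^∞])/im κ_v` along the cyclotomic tower is surjective) = `Greenberg1999.localQuotient_restriction_surjective_holds`
  (Literature `Greenberg1999/LocalQuotientControlSurjectiveProofs`).

So the pack follows from its TWO remaining cite-only conjuncts — conjunct 2 `prop412_noFiniteSubmodule_H1Sigma_of_rank_one`
(Greenberg Prop. 4.12 p. 119, proof pp. 114–118: Shapiro's lemma for `𝒜 = Hom(Λ, E[p^∞])`, the twists `θ_s`, `cd_p = 2` /
Lemma 4.11) and conjunct 5 `h1SigmaInfty_rank_eq_one` (§5 p. 140: weak Leopoldt for `E[p^∞]` over `ℚ_∞` = Kato Thm. 12.4) —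
`publishedInputsGreenbergControlAtTwo_of_two` (item signature VERBATIM). The display of 24143 on both routes is thereby
5 → 2 once a pen re-keys; nothing else changes.

## Honest framing

CONDITIONAL (two named Greenberg/Kato facts as hypotheses; neither is formalised — each needs the cohomology of
`Gal(ℚ_Σ/ℚ)` in degree 2 with `Λ`-coefficients, resp. Kato's Euler system, absent from the tree) and closes nothing: 24143 is a
permanently-held published-input pack, ASIDE since K4 `SignedControlAtTwo` (20309) was proved outright on 2026-08-28 by the line
`eulerchar` without it. No crux and no summit statement is proved; the Birch–Swinnerton-Dyer conjecture is NOT proved by any of this.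

References: [GreenbergLNM1716] §4 Appendix Prop. 4.13 (p. 122), Prop. 4.12 (p. 119), pp. 108, 113–120, §5 p. 140;
[Kato2004Asterisque] Thm. 12.4; [Cassels1964ArithmeticVII]; [MilneADT2006] I Thm. 4.10.
-/

namespace Summit.BirchSwinnertonDyer.BirchSwinnertonDyer.Theorems.InputsPoitouTateSelmer

open Literature.NumberTheory.GaloisCohomology Literature.NumberTheory.EllipticCurves
  Literature.NumberTheory.EllipticCurves.Greenberg1999

/-- **Item 24143 `PublishedInputsGreenbergControlAtTwo` (signature VERBATIM) from its TWO cite-only conjuncts**: Greenberg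
Prop. 4.12 (`h412`) and weak Leopoldt in `Λ`-corank form (`hrank1`, §5 p. 140 / Kato Thm. 12.4). Conjunct 1 (Cassels, Prop. 4.13)
is `casselsSurjectivity_H1Sigma_holds ℚ`, conjunct 3 (corank count pp. 119–120) is
`SignedEC.H1SigmaCorank.h1Sigma_zpCorank_le_degree_holds_rat`, conjunct 4 (local quotients p. 108) is
`localQuotient_restriction_surjective_holds` — all tree theorems. The certified collapse term for the pens of `ThetaPartnerAtTwo` /
`ResidualThetaTransportAtTwo` (binder `hPubG`; displayed print inputs 5 → 2). Conditional; closes nothing; BSD is not proved by this.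
[cite: GreenbergLNM1716, Prop. 4.12 p. 119; §5 p. 140; Prop. 4.13 p. 122; pp. 108 and 119–120]
[cite: Kato2004Asterisque, Thm. 12.4 (1)(2) p. 221] -/
theorem publishedInputsGreenbergControlAtTwo_of_two
    (h412 : prop412_noFiniteSubmodule_H1Sigma_of_rank_one) (hrank1 : h1SigmaInfty_rank_eq_one) :
    casselsSurjectivity_H1Sigma ℚ ∧ prop412_noFiniteSubmodule_H1Sigma_of_rank_one ∧ h1Sigma_zpCorank_le_degree ℚ ∧
      localQuotient_restriction_surjective ℚ ∧ h1SigmaInfty_rank_eq_one :=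
  publishedInputsGreenbergControlAtTwo_of_four h412 SignedEC.H1SigmaCorank.h1Sigma_zpCorank_le_degree_holds_rat
    localQuotient_restriction_surjective_holds hrank1

/-- **The three PROVED conjuncts of the pack, bundled** (Cassels Prop. 4.13 over `ℚ`, the corank count pp. 119–120, the
local-quotient surjectivity p. 108) — hypothesis-free, for pens that prefer to re-key 24143 as «two named facts ∧ this».
[cite: GreenbergLNM1716, Prop. 4.13 p. 122; pp. 108 and 119–120] -/
theorem publishedInputsGreenbergControlAtTwo_provedConjuncts :
    casselsSurjectivity_H1Sigma ℚ ∧ h1Sigma_zpCorank_le_degree ℚ ∧ localQuotient_restriction_surjective ℚ :=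
  ⟨casselsSurjectivity_H1Sigma_holds ℚ, SignedEC.H1SigmaCorank.h1Sigma_zpCorank_le_degree_holds_rat,
    localQuotient_restriction_surjective_holds⟩

end Summit.BirchSwinnertonDyer.BirchSwinnertonDyer.Theorems.InputsPoitouTateSelmer
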